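import Summits.BirchSwinnertonDyer.BirchSwinnertonDyer.Theorems.AlignedTransportAtTwoMainConjectureOfRankZeroBSDAtTwoFineRoadKleinCountingS3
import Mathlib.Algebra.Module.ZMod
import Mathlib.LinearAlgebra.Dual.Lemmas
import Mathlib.LinearAlgebra.Basis.VectorSpace
import Mathlib.Algebra.Module.Submodule.Pointwise
import Mathlib.GroupTheory.Coset.Basic
import HarnessLib

/-!
# Route `AlignedTransportAtTwo`, crux C2 `MainConjectureOfRankZeroBSDAtTwo` (stmt-BirchSwinnertonDyer-22298),
# road (b″): PERFECT DESCENT at `2`, part IX — the counting lemma WITHOUT finiteness and WITHOUT `2`-torsion: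
# `Hom_σ(X, V₄) ≃ Hom(W, ℤ/2)` for `W = ker(1 + σ + σ²) ⊆ X`, and `Hom(U, ℤ/2)` finite `⟺` `U/2U` finite

Cell `bsd-f1-sign2`, WIDTH-5 attach seat `bsd-line-att-p3` (gen 5) on line `birth` of crux C2
(`--supports` stmt-BirchSwinnertonDyer-22298; closes nothing). HONEST FRAMING: THEOREMS ONLY — no definition, no
named fact, no instance, no `sorry`; BSD is NOT proved by any of this. This is the first half of the lead's FREE
target (c1), SECOND PART (bus 2026-08-28T04:46:58Z: «… and its Λ-form «`Hom_{S₃}(M/2M, V₄)` finite ⟺ `(1 − e₁)M` is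
`Λ`-torsion with `μ = 0`» for `M` f.g. over `Λ = ℤ₂⟦T⟧ with commuting `S₃`-action»), i.e. PERFECT-DESCENT.md §3 (iii) in
the form the `Λ`-adic statement consumes: the module is no longer finite and no longer killed by `2`.

Setting (parts VI–VIII): a group `Q` acts on the Klein four-group `M` (`#M = 4`, `m + m = 0`) with a fixed-point-free
`σ ∈ Q` (a `3`-cycle), and additively on an abelian group `X` with `σ³ = 1` on `X` (e.g. the kernel of the action on
`M` acts trivially on `X`). NO hypothesis `x + x = 0` and NO finiteness of `X`.

## What is proved

* §1 **`nonempty_sigmaEquivariant_equiv_addMonoidHom`**: for ANY additive subgroup `W ⊆ X` (of any `SetLike`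
  subgroup class — an `AddSubgroup`, or a `Λ`-`Submodule`) with `W ⊆ ker(1 + σ + σ²)` and `(2 − σ − σ²)X ⊆ W` (so
  `W = ker(1 + σ + σ²) = (1 − e₁)X` as soon as `3` is invertible on `X`, e.g. `X` a `ℤ₂`- or `Λ`-module), an EXPLICIT
  bijection `{f : X →+ M | f σ = σ f} ≃ (W →+ ℤ/2)`: `φ ↦ (x ↦ σ•ι φ(F x) + σ²•ι φ(F σx))` with `F x = 2x − σx − σ²x`
  and `ι : ℤ/2 ↪ M`, inverse `f ↦ p ∘ f|_W` for a coordinate `p : M ↠ ℤ/2` (from the tree's `klein_exists_addEquiv`);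
  corollaries `natCard_sigmaEquivariant_eq_natCard_addMonoidHom` and `finite_sigmaEquivariant_iff_addMonoidHom`.
  (Part VI's `natCard_sigmaEquivariant_eq` is the case `x + x = 0`, `X` finite, where `(W →+ ℤ/2)` has `#W` elements.)
* §2 the image-of-`ρ̄` reductions WITHOUT finiteness: **`finite_sigmaEquivariant_iff_sigmaTau`** (`Hom_σ` finite ⟺
  `Hom_{σ,τ}` finite: the averaging operator `T f = f + τ f τ` of part VII has kernel inside `Hom_{σ,τ}`, and a group with
  finite quotient and finite kernel is finite), hence **`finite_equivariant_iff_sigmaEquivariant_S3`** (`Q̄ = S₃`) and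
  **`finite_equivariant_iff_sigmaEquivariant_of_no_transposition`** (`Q̄ = C₃`).
* §3 **`finite_addMonoidHom_zmodTwo_iff`**: for a module `U` over any commutative ring `R`,
  `(U →+ ℤ/2)` is finite ⟺ `U ⧸ 2U` is finite (`U/2U` is an `𝔽₂`-vector space and its dual separates points —
  Mathlib `Module.Projective.exists_dual_ne_zero`).

The `Λ`-adic conclusion (`U/2U` finite ⟺ `U₍₂₎ = 0` ⟺ `U` torsion with `μ = 0`, for `U` f.g. over `ℤ₂⟦T⟧`) is the sequel
`…FineRoadKleinCountingLambda`.

References: J.-P. Serre, *Linear Representations of Finite Groups*, §2.6; K. S. Brown, *Cohomology of Groups*, VI.8;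
PERFECT-DESCENT.md §3 (iii) (lead att-p2 g4).
-/

set_option autoImplicit false
-- the Theorems namespace of this sub repeats the summit name by design (D-0017 nested layout)
set_option linter.dupNamespace false

namespace Summit.BirchSwinnertonDyer.BirchSwinnertonDyer.Theorems.AlignedTransportAtTwoFineRoad.PerfectDescent

open Summit.BirchSwinnertonDyer.BirchSwinnertonDyer.Theorems.MultTransportAtTwo

/-! ## §1 `Hom_σ(X, M) ≃ (W →+ ℤ/2)` for any `X` with `σ³ = 1` -/

section SigmaDual

variable {Q : Type*} [Group Q] {M : Type*} [AddCommGroup M] [DistribMulAction Q M]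
  {X : Type*} [AddCommGroup X] [DistribMulAction Q X]

/-- **The `σ`-equivariant maps `X → V₄` are the additive maps `W → ℤ/2`**, `W = ker(1 + σ + σ²)`. Let `σ ∈ Q` act
without non-zero fixed point on the Klein four-group `M` and with `σ³ = 1` on the abelian group `X`; let `W ⊆ X` be an
additive subgroup (of any subgroup class: `AddSubgroup`, `Submodule`, …) with `w + σw + σ²w = 0` on `W` and
`2x − σx − σ²x ∈ W` for all `x` (for `X` a module over a ring containing `3⁻¹` these say `W = ker(1 + σ + σ²) =
(1 − e₁)X`). Then there is a bijection `{f : X →+ M | f ∘ σ = σ ∘ f} ≃ (W →+ ℤ/2)`: a `σ`-equivariant map kills the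
`σ`-invariants (`fpf`), hence is determined by its restriction to `W` (`3x ∈ X^σ + W`), on which it is `𝔽₄ =
𝔽₂[σ]`-semilinear into `M ≅ 𝔽₄` and so the same as its `ω`-coordinate `W → 𝔽₂`; explicitly `φ ↦ (x ↦ σ•ι φ(F x) +
σ²•ι φ(F σx))`, `F x = 2x − σx − σ²x`, `ι 1 = m₀`, with inverse `f ↦ p ∘ f|_W` for the coordinate `p : M → ℤ/2`
vanishing on `σ²m₀`. No finiteness and no `2`-torsion of `X` is assumed. [cite: SerreGaloisCohomology1997, I §5.1] -/
theorem nonempty_sigmaEquivariant_equiv_addMonoidHom (h4 : Nat.card M = 4) (h2 : ∀ m : M, m + m = 0) {σ : Q}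
    (hσ : ∀ m : M, σ • m = m → m = 0) (hσ3 : ∀ x : X, σ • (σ • (σ • x)) = x)
    {S : Type*} [SetLike S X] [AddSubgroupClass S X] (W : S)
    (hW : ∀ w : X, w ∈ W → w + σ • w + σ • (σ • w) = 0)
    (hF : ∀ x : X, x + x - σ • x - σ • (σ • x) ∈ W) :
    Nonempty ({f : X →+ M // ∀ x : X, f (σ • x) = σ • f x} ≃ (W →+ ZMod 2)) := by
  classical
  have hσ3M : ∀ m : M, σ • (σ • (σ • m)) = m := smul_smul_smul_eq_self_of_fpf h4 h2 hσ
  have hσσM : ∀ m : M, σ • (σ • m) = m + σ • m := smul_smul_eq_add_of_fpf h4 h2 hσ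
  have hplusM : ∀ m : M, σ • m + σ • (σ • m) = m := fun m ↦ by
    rw [hσσM, add_left_comm, h2, add_zero]
  -- arithmetic of `ℤ/2`
  have hz2 : ∀ a : ZMod 2, a + a = 0 := by decide
  have hzneg : ∀ a : ZMod 2, -a = a := by decide
  have hzc : ∀ a : ZMod 2, a = 0 ∨ a = 1 := by decide
  have hz10 : (1 : ZMod 2) ≠ 0 := by decide
  -- the map `F x = 2x − σx − σ²x`, valued in `W`
  let F₀ : X →+ X := AddMonoidHom.mk' (fun x ↦ x + x - σ • x - σ • (σ • x)) (by
    intro a b; simp only [smul_add]; abel)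
  have hF₀ : ∀ x : X, F₀ x = x + x - σ • x - σ • (σ • x) := fun _ ↦ rfl
  let F : X →+ W := AddMonoidHom.codRestrict F₀ W (fun x ↦ by rw [hF₀]; exact hF x)
  have hFv : ∀ x : X, ((F x : W) : X) = x + x - σ • x - σ • (σ • x) := fun _ ↦ rfl
  have hF₀σ : ∀ x : X, F₀ (σ • x) = σ • F₀ x := fun x ↦ by
    rw [hF₀, hF₀, smul_sub, smul_sub, smul_add, hσ3]
  have hFσσ : ∀ x : X, F (σ • (σ • x)) = -F x - F (σ • x) := fun x ↦ Subtype.ext (by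
    rw [AddSubgroupClass.coe_sub, NegMemClass.coe_neg, hFv, hFv, hFv]
    simp only [hσ3]
    abel)
  have hFW : ∀ w : W, F (w : X) = w + w + w := fun w ↦ Subtype.ext (by
    simp only [AddMemClass.coe_add, hFv]
    have e := hW w w.2
    have e' : σ • (w : X) + σ • (σ • (w : X)) = -(w : X) := by
      rw [add_assoc] at e; exact (neg_eq_of_add_eq_zero_right e).symm
    rw [sub_sub, e']; abel)
  -- `ι : ℤ/2 ↪ M`, `1 ↦ m₀`
  obtain ⟨m₀, hm₀⟩ := klein_exists_ne_zero h4
  have hσm0 : σ • m₀ ≠ 0 := fun h ↦ hm₀ ((smul_eq_zero_iff_eq σ).mp h)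
  have hσm : σ • m₀ ≠ m₀ := fun h ↦ hm₀ (hσ m₀ h)
  let ι : ZMod 2 →+ M := AddMonoidHom.mk' (fun a ↦ if a = 0 then 0 else m₀) (by
    intro a b
    rcases hzc a with rfl | rfl <;> rcases hzc b with rfl | rfl <;>
      simp [hz10, hz2, h2])
  have hι0 : ι 0 = 0 := by simp [ι]
  have hι1 : ι 1 = m₀ := by simp [ι, hz10]
  -- the coordinate `p : M ↠ ℤ/2` with `p m₀ = p (σ m₀) = 1`
  have hA4 : Nat.card (ZMod 2 × ZMod 2) = 4 := by
    rw [Nat.card_prod, Nat.card_eq_fintype_card, ZMod.card]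
  have hAA2 : ∀ x : ZMod 2 × ZMod 2, x + x = 0 := by decide
  have hne1 : ((1, 0) : ZMod 2 × ZMod 2) ≠ 0 := by decide
  have hne2 : ((1, 1) : ZMod 2 × ZMod 2) ≠ 0 := by decide
  have hne3 : ((1, 0) : ZMod 2 × ZMod 2) ≠ (1, 1) := by decide
  obtain ⟨θ, hθa, hθb⟩ := klein_exists_addEquiv h4 h2 hA4 hAA2 hm₀ hσm0 (Ne.symm hσm) hne1 hne2 hne3
  let p : M →+ ZMod 2 := (AddMonoidHom.fst (ZMod 2) (ZMod 2)).comp θ.toAddMonoidHom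
  have hpapply : ∀ x : M, p x = (θ x).1 := fun _ ↦ rfl
  have hp0 : p 0 = 0 := map_zero p
  have hpa : p m₀ = 1 := by rw [hpapply, hθa]
  have hpb : p (σ • m₀) = 1 := by rw [hpapply, hθb]
  have hpc : p (m₀ + σ • m₀) = 0 := by rw [map_add, hpa, hpb]; exact hz2 1
  have hσσm₀ : σ • (σ • m₀) = m₀ + σ • m₀ := hσσM m₀
  have hpσ : ∀ a : ZMod 2, p (σ • ι a) = a := by
    intro a
    rcases hzc a with rfl | rfl
    · rw [hι0, smul_zero, hp0]
    · rw [hι1, hpb]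
  have hpσσ : ∀ a : ZMod 2, p (σ • (σ • ι a)) = 0 := by
    intro a
    rcases hzc a with rfl | rfl
    · rw [hι0, smul_zero, smul_zero, hp0]
    · rw [hι1, hσσm₀, hpc]
  -- the reconstruction identity `x = σ • ι (p x) + σ² • ι (p (σ x))` on `M`
  have hrec : ∀ x : M, σ • ι (p x) + σ • (σ • ι (p (σ • x))) = x := by
    intro x
    rcases klein_cases h4 h2 hm₀ hσm0 (Ne.symm hσm) x with h | h | h | h <;> rw [h]
    · rw [smul_zero, hp0, hι0, smul_zero, smul_zero, add_zero]
    · rw [hpa, hpb, hι1]; exact hplusM m₀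
    · rw [hpb, hι1, hσσm₀, hpc, hι0, smul_zero, smul_zero, add_zero]
    · have e : σ • (m₀ + σ • m₀) = m₀ := by rw [← hσσm₀]; exact hσ3M m₀
      rw [hpc, hι0, smul_zero, zero_add, e, hpa, hι1]
      exact hσσm₀
  -- the bijection
  let Ψ : {f : X →+ M // ∀ x : X, f (σ • x) = σ • f x} → (W →+ ZMod 2) :=
    fun f ↦ p.comp (f.1.comp (AddSubmonoidClass.subtype W))
  let Φ : (W →+ ZMod 2) → {f : X →+ M // ∀ x : X, f (σ • x) = σ • f x} := fun φ ↦
    ⟨(DistribSMul.toAddMonoidHom M σ).comp (ι.comp (φ.comp F)) +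
        (DistribSMul.toAddMonoidHom M (σ * σ)).comp (ι.comp (φ.comp (F.comp
          (DistribSMul.toAddMonoidHom X σ)))), by
      intro x
      change σ • ι (φ (F (σ • x))) + (σ * σ) • ι (φ (F (σ • (σ • x)))) =
        σ • (σ • ι (φ (F x)) + (σ * σ) • ι (φ (F (σ • x))))
      rw [hFσσ, map_sub φ, map_neg φ, hzneg, sub_eq_add_neg, hzneg, map_add ι, mul_smul, mul_smul,
        smul_add, smul_add, smul_add, hσ3M, add_left_comm, hplusM]⟩
  have hΦ : ∀ (φ : W →+ ZMod 2) (x : X), (Φ φ).1 x =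
      σ • ι (φ (F x)) + σ • (σ • ι (φ (F (σ • x)))) := fun φ x ↦ by
    change σ • ι (φ (F x)) + (σ * σ) • ι (φ (F (σ • x))) = _
    rw [mul_smul]
  have hΨ : ∀ (f : {f : X →+ M // ∀ x : X, f (σ • x) = σ • f x}) (w : W), Ψ f w = p (f.1 w) :=
    fun _ _ ↦ rfl
  have hleft : ∀ f, Φ (Ψ f) = f := by
    intro f
    apply Subtype.ext
    ext x
    have hFσ' : ((F (σ • x) : W) : X) = σ • ((F x : W) : X) := by
      change F₀ (σ • x) = σ • F₀ x
      exact hF₀σ x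
    rw [hΦ, hΨ, hΨ, hFσ', f.2, hrec, hFv, map_sub, map_sub, map_add, f.2, f.2, f.2, h2, zero_sub,
      sub_eq_add_neg, ← neg_add, hplusM, klein_neg_eq h2]
  have hright : ∀ φ, Ψ (Φ φ) = φ := by
    intro φ
    ext w
    rw [hΨ, hΦ, map_add, hpσ, hpσσ, add_zero, hFW, map_add, map_add, hz2, zero_add]
  exact ⟨⟨Ψ, Φ, hleft, hright⟩⟩

/-- **Counting WITHOUT `2`-torsion**: `#Hom_σ(X, M) = #(W →+ ℤ/2)` (as `Nat.card`s; both sides may be infinite, then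
both cards are `0`), `W` as in `nonempty_sigmaEquivariant_equiv_addMonoidHom`. For finite `W` the right side is
`#(W/2W)`; for `x + x = 0` on `X` this is part VI's `#((1 − e₁)V)`. [cite: SerreGaloisCohomology1997, I §5.1] -/
theorem natCard_sigmaEquivariant_eq_natCard_addMonoidHom (h4 : Nat.card M = 4) (h2 : ∀ m : M, m + m = 0)
    {σ : Q} (hσ : ∀ m : M, σ • m = m → m = 0) (hσ3 : ∀ x : X, σ • (σ • (σ • x)) = x)
    {S : Type*} [SetLike S X] [AddSubgroupClass S X] (W : S)
    (hW : ∀ w : X, w ∈ W → w + σ • w + σ • (σ • w) = 0)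
    (hF : ∀ x : X, x + x - σ • x - σ • (σ • x) ∈ W) :
    Nat.card {f : X →+ M // ∀ x : X, f (σ • x) = σ • f x} = Nat.card (W →+ ZMod 2) := by
  obtain ⟨e⟩ := nonempty_sigmaEquivariant_equiv_addMonoidHom h4 h2 hσ hσ3 W hW hF
  exact Nat.card_congr e

/-- **Finiteness form**: `Hom_σ(X, M)` is finite iff `(W →+ ℤ/2)` is, `W = ker(1 + σ + σ²)` as in
`nonempty_sigmaEquivariant_equiv_addMonoidHom` — the shape the `Λ`-adic counting lemma consumes (`X = ` an
Iwasawa module, infinite, not killed by `2`). [cite: SerreGaloisCohomology1997, I §5.1] -/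
theorem finite_sigmaEquivariant_iff_addMonoidHom (h4 : Nat.card M = 4) (h2 : ∀ m : M, m + m = 0)
    {σ : Q} (hσ : ∀ m : M, σ • m = m → m = 0) (hσ3 : ∀ x : X, σ • (σ • (σ • x)) = x)
    {S : Type*} [SetLike S X] [AddSubgroupClass S X] (W : S)
    (hW : ∀ w : X, w ∈ W → w + σ • w + σ • (σ • w) = 0)
    (hF : ∀ x : X, x + x - σ • x - σ • (σ • x) ∈ W) :
    Finite {f : X →+ M // ∀ x : X, f (σ • x) = σ • f x} ↔ Finite (W →+ ZMod 2) := by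
  obtain ⟨e⟩ := nonempty_sigmaEquivariant_equiv_addMonoidHom h4 h2 hσ hσ3 W hW hF
  exact Equiv.finite_iff e

end SigmaDual

/-! ## §2 `Q̄ = S₃` and `Q̄ = C₃` without finiteness: `Hom_Q` finite ⟺ `Hom_σ` finite -/

section Image

variable {Q : Type*} [Group Q] {M : Type*} [AddCommGroup M] [DistribMulAction Q M]
  {X : Type*} [AddCommGroup X] [DistribMulAction Q X]

/-- **`Hom_σ(X, M)` finite ⟺ `Hom_{σ,τ}(X, M)` finite** (no finiteness of `X`): `⟸` because the averaging operator
`T f = f + τ f τ` (part VII) maps `Hom_σ` additively to `Hom_{σ,τ}` with kernel consisting of `τ`-equivariant maps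
(`-1 = 1` on `M`), so `Hom_σ` is an extension of a subgroup of `Hom_{σ,τ}` by a subgroup of `Hom_{σ,τ}`; `⟹` is the
inclusion. Hypotheses as in part VII (`τ` a transposition fixing `m₀ ≠ 0`; the kernel of the action on `M` acts
trivially on `X`). [cite: SerreGaloisCohomology1997, I §5.1] -/
theorem finite_sigmaEquivariant_iff_sigmaTau (h4 : Nat.card M = 4) (h2 : ∀ m : M, m + m = 0) {σ τ : Q}
    {m₀ : M} (hσ : ∀ m : M, σ • m = m → m = 0) (hm₀ : m₀ ≠ 0) (hτ0 : τ • m₀ = m₀) (hτ : ¬ ∀ m : M, τ • m = m)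
    (hVN : ∀ g : Q, (∀ m : M, g • m = m) → ∀ x : X, g • x = x) :
    Finite {f : X →+ M // ∀ x : X, f (σ • x) = σ • f x} ↔
      Finite {f : X →+ M // (∀ x : X, f (σ • x) = σ • f x) ∧ ∀ x : X, f (τ • x) = τ • f x} := by
  classical
  refine ⟨fun _ ↦ Finite.of_injective
    (fun f : {f : X →+ M // (∀ x : X, f (σ • x) = σ • f x) ∧ ∀ x : X, f (τ • x) = τ • f x} ↦
      (⟨f.1, f.2.1⟩ : {f : X →+ M // ∀ x : X, f (σ • x) = σ • f x})) fun f g h ↦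
      Subtype.ext (congrArg (fun x : {f : X →+ M // ∀ x : X, f (σ • x) = σ • f x} ↦ x.1) h), fun hfin ↦ ?_⟩
  have hττ := tau_tau h4 h2 hσ hm₀ hτ0 hτ
  have hτσσ := tau_sigma_sigma h4 h2 hσ hm₀ hτ0 hτ
  have hττV := tau_tau_V h4 h2 hσ hm₀ hτ0 hτ hVN
  have hτσV := tau_sigma_V h4 h2 hσ hm₀ hτ0 hτ hVN
  -- the two subgroups of `X →+ M`
  let Lσ : AddSubgroup (X →+ M) :=
    { carrier := {f | ∀ x : X, f (σ • x) = σ • f x}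
      zero_mem' := fun x ↦ by rw [AddMonoidHom.zero_apply, AddMonoidHom.zero_apply, smul_zero]
      add_mem' := fun {f g} hf hg x ↦ by rw [AddMonoidHom.add_apply, AddMonoidHom.add_apply, hf, hg, smul_add]
      neg_mem' := fun {f} hf x ↦ by rw [AddMonoidHom.neg_apply, AddMonoidHom.neg_apply, hf, smul_neg] }
  let Lστ : AddSubgroup (X →+ M) :=
    { carrier := {f | (∀ x : X, f (σ • x) = σ • f x) ∧ ∀ x : X, f (τ • x) = τ • f x}
      zero_mem' := ⟨fun x ↦ by rw [AddMonoidHom.zero_apply, AddMonoidHom.zero_apply, smul_zero],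
        fun x ↦ by rw [AddMonoidHom.zero_apply, AddMonoidHom.zero_apply, smul_zero]⟩
      add_mem' := fun {f g} hf hg ↦ ⟨fun x ↦ by
          rw [AddMonoidHom.add_apply, AddMonoidHom.add_apply, hf.1, hg.1, smul_add],
        fun x ↦ by rw [AddMonoidHom.add_apply, AddMonoidHom.add_apply, hf.2, hg.2, smul_add]⟩
      neg_mem' := fun {f} hf ↦ ⟨fun x ↦ by rw [AddMonoidHom.neg_apply, AddMonoidHom.neg_apply, hf.1, smul_neg],
        fun x ↦ by rw [AddMonoidHom.neg_apply, AddMonoidHom.neg_apply, hf.2, smul_neg]⟩ }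
  have hLσ : ∀ f : X →+ M, f ∈ Lσ ↔ ∀ x : X, f (σ • x) = σ • f x := fun _ ↦ Iff.rfl
  have hLστ : ∀ f : X →+ M, f ∈ Lστ ↔ (∀ x : X, f (σ • x) = σ • f x) ∧ ∀ x : X, f (τ • x) = τ • f x :=
    fun _ ↦ Iff.rfl
  haveI hfinστ : Finite Lστ :=
    Finite.of_equiv _ (Equiv.subtypeEquivRight fun f ↦ (hLστ f).symm)
  -- the conjugate `τ f τ` and the averaging operator `T`
  let c : (X →+ M) →+ (X →+ M) :=
    { toFun := fun f ↦ (DistribSMul.toAddMonoidHom M τ).comp (f.comp (DistribSMul.toAddMonoidHom X τ))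
      map_zero' := by ext x; simp
      map_add' := fun f g ↦ by ext x; simp [smul_add] }
  have hc : ∀ (f : X →+ M) (x : X), c f x = τ • f (τ • x) := fun _ _ ↦ rfl
  have hcσ : ∀ f : X →+ M, f ∈ Lσ → c f ∈ Lσ := fun f hf x ↦ by
    rw [hc, hc, hτσV, hf, hf, hτσσ]
  let T : Lσ →+ Lστ :=
    { toFun := fun f ↦ ⟨f.1 + c f.1, ⟨(hLσ _).mp (Lσ.add_mem f.2 (hcσ f.1 f.2)), fun x ↦ by
        rw [AddMonoidHom.add_apply, AddMonoidHom.add_apply, hc, hc, hττV, smul_add, hττ, add_comm]⟩⟩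
      map_zero' := Subtype.ext (by simp)
      map_add' := fun f g ↦ Subtype.ext (by
        simp only [AddSubgroup.coe_add, map_add]; abel) }
  have hT : ∀ f : Lσ, ((T f : Lστ) : X →+ M) = f.1 + c f.1 := fun _ ↦ rfl
  -- the kernel of `T` consists of `τ`-equivariant maps
  have hker : ∀ f : Lσ, f ∈ T.ker → (f.1 : X →+ M) ∈ Lστ := by
    intro f hf
    rw [AddMonoidHom.mem_ker] at hf
    have h0 : f.1 + c f.1 = 0 := by rw [← hT, hf]; rfl
    refine ⟨f.2, fun x ↦ ?_⟩
    have hx := congrArg (fun g : X →+ M ↦ g (τ • x)) h0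
    simp only [AddMonoidHom.add_apply, hc, hττV, AddMonoidHom.zero_apply] at hx
    rw [← klein_neg_eq h2 (τ • f.1 x)]
    exact eq_neg_of_add_eq_zero_left hx
  let ι : T.ker → Lστ := fun f ↦ ⟨(f.1 : Lσ).1, hker f.1 f.2⟩
  have hι : Function.Injective ι := by
    intro f g hfg
    apply Subtype.ext; apply Subtype.ext
    exact congrArg (fun x : Lστ ↦ (x : X →+ M)) hfg
  -- finiteness: `Lσ ≃ (Lσ ⧸ ker T) × ker T`, `Lσ ⧸ ker T ≃ range T ≤ Lστ`, `ker T ↪ Lστ`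
  haveI : Finite T.ker := Finite.of_injective ι hι
  haveI : Finite T.range := inferInstance
  haveI : Finite (Lσ ⧸ T.ker) := Finite.of_equiv _ (QuotientAddGroup.quotientKerEquivRange T).toEquiv.symm
  haveI : Finite Lσ := Finite.of_equiv _ (AddSubgroup.addGroupEquivQuotientProdAddSubgroup (s := T.ker)).symm
  exact Finite.of_equiv _ (Equiv.subtypeEquivRight fun f ↦ hLσ f)

/-- **`Q̄ = S₃`: `Hom_Q(X, M)` finite ⟺ `Hom_σ(X, M)` finite** (`Hom_Q = Hom_{σ,τ}` by part VII's
`equivariant_iff_sigma_tau`, then `finite_sigmaEquivariant_iff_sigmaTau`). [cite: SerreGaloisCohomology1997, I §5.1] -/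
theorem finite_equivariant_iff_sigmaEquivariant_S3 (h4 : Nat.card M = 4) (h2 : ∀ m : M, m + m = 0) {σ τ : Q}
    {m₀ : M} (hσ : ∀ m : M, σ • m = m → m = 0) (hm₀ : m₀ ≠ 0) (hτ0 : τ • m₀ = m₀) (hτ : ¬ ∀ m : M, τ • m = m)
    (hVN : ∀ g : Q, (∀ m : M, g • m = m) → ∀ x : X, g • x = x) :
    Finite {f : X →+ M // ∀ (g : Q) (x : X), f (g • x) = g • f x} ↔
      Finite {f : X →+ M // ∀ x : X, f (σ • x) = σ • f x} := by
  rw [finite_sigmaEquivariant_iff_sigmaTau h4 h2 hσ hm₀ hτ0 hτ hVN]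
  exact Equiv.finite_iff (Equiv.subtypeEquivRight fun f ↦ equivariant_iff_sigma_tau h4 h2 hσ hm₀ hτ0 hτ hVN f)

/-- **`Q̄ = C₃`: `Hom_Q(X, M) = Hom_σ(X, M)`** as far as finiteness goes (indeed as sets: part VI's
`equivariant_of_sigmaEquivariant_of_no_transposition`), when no element of `Q` acts on `M` as a transposition.
[cite: SerreGaloisCohomology1997, I §5.1] -/
theorem finite_equivariant_iff_sigmaEquivariant_of_no_transposition (h4 : Nat.card M = 4)
    (h2 : ∀ m : M, m + m = 0) {σ : Q} (hσ : ∀ m : M, σ • m = m → m = 0)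
    (hnoT : ∀ g : Q, (∀ m : M, g • m = m) ∨ (∀ m : M, g • m = m → m = 0))
    (hVN : ∀ g : Q, (∀ m : M, g • m = m) → ∀ x : X, g • x = x) :
    Finite {f : X →+ M // ∀ (g : Q) (x : X), f (g • x) = g • f x} ↔
      Finite {f : X →+ M // ∀ x : X, f (σ • x) = σ • f x} :=
  Equiv.finite_iff (Equiv.subtypeEquivRight fun f ↦
    ⟨fun h x ↦ h σ x, fun h g x ↦ equivariant_of_sigmaEquivariant_of_no_transposition h4 h2 hσ hnoT hVN f h g x⟩)

end Image

/-! ## §3 `(U →+ ℤ/2)` is finite iff `U/2U` is -/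

section DualTwo

open Pointwise

variable {R : Type*} [CommRing R] {U : Type*} [AddCommGroup U] [Module R U]

/-- **`Hom(U, ℤ/2)` is finite ⟺ `U/2U` is finite**, for a module `U` over any commutative ring `R` (`2U = 2 • ⊤`, the
pointwise multiple). `⟸`: an additive map to `ℤ/2` kills `2U`, so it is determined by its values on a set of
representatives. `⟹`: `U/2U` is a vector space over `𝔽₂`, whose linear functionals separate points (Mathlib
`Module.Projective.exists_dual_ne_zero`); composed with `U ↠ U/2U` they are additive maps `U → ℤ/2`, so if there are
only finitely many of those, `U/2U` embeds into a finite set of value-tuples. [folklore] -/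
theorem finite_addMonoidHom_zmodTwo_iff :
    Finite (U →+ ZMod 2) ↔ Finite (U ⧸ ((2 : R) • (⊤ : Submodule R U))) := by
  classical
  set N : Submodule R U := (2 : R) • (⊤ : Submodule R U) with hN
  have hz2 : ∀ a : ZMod 2, 2 • a = 0 := by decide
  -- every additive map to `ℤ/2` kills `N = 2U`
  have hkill : ∀ (φ : U →+ ZMod 2) (u : U), u ∈ N → φ u = 0 := by
    intro φ u hu
    obtain ⟨b, -, rfl⟩ := (Submodule.mem_smul_pointwise_iff_exists u (2 : R) ⊤).mp hu
    rw [ofNat_smul_eq_nsmul, map_nsmul, hz2]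
  -- a set-theoretic section of `U ↠ U/N`
  let s : U ⧸ N → U := Function.surjInv N.mkQ_surjective
  have hs : ∀ n : U ⧸ N, N.mkQ (s n) = n := Function.surjInv_eq N.mkQ_surjective
  have hsu : ∀ u : U, u - s (N.mkQ u) ∈ N := fun u ↦
    (Submodule.Quotient.eq N).mp (hs (N.mkQ u)).symm
  constructor
  · intro hfin
    -- `U/N` is an `𝔽₂`-vector space; its dual separates points
    have hN2 : ∀ x : U ⧸ N, 2 • x = 0 := by
      intro x
      obtain ⟨u, rfl⟩ := N.mkQ_surjective x
      rw [← map_nsmul, Submodule.mkQ_apply, Submodule.Quotient.mk_eq_zero, ← ofNat_smul_eq_nsmul (R := R)]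
      exact Submodule.smul_mem_pointwise_smul u (2 : R) ⊤ Submodule.mem_top
    letI : Module (ZMod 2) (U ⧸ N) := AddCommGroup.zmodModule hN2
    let E : U ⧸ N → ((U →+ ZMod 2) → ZMod 2) := fun n φ ↦ φ (s n)
    refine Finite.of_injective E fun n n' hnn' ↦ ?_
    by_contra hne
    have hx : n - n' ≠ 0 := sub_ne_zero.mpr hne
    obtain ⟨ψ, hψ⟩ := Module.Projective.exists_dual_ne_zero (ZMod 2) hx
    let φ : U →+ ZMod 2 := ψ.toAddMonoidHom.comp N.mkQ.toAddMonoidHom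
    have hφ : ∀ u : U, φ u = ψ (N.mkQ u) := fun _ ↦ rfl
    have h := congrFun hnn' φ
    simp only [E, hφ, hs] at h
    apply hψ
    rw [map_sub, h, sub_self]
  · intro hfin
    let Γ : (U →+ ZMod 2) → (U ⧸ N → ZMod 2) := fun φ n ↦ φ (s n)
    refine Finite.of_injective Γ fun φ ψ h ↦ ?_
    ext u
    have h1 : φ (u - s (N.mkQ u)) = 0 := hkill φ _ (hsu u)
    have h2 : ψ (u - s (N.mkQ u)) = 0 := hkill ψ _ (hsu u)
    rw [map_sub, sub_eq_zero] at h1 h2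
    rw [h1, h2]
    exact congrFun h (N.mkQ u)

end DualTwo

end Summit.BirchSwinnertonDyer.BirchSwinnertonDyer.Theorems.AlignedTransportAtTwoFineRoad.PerfectDescent
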